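import Summits.ResolutionOfSingularities.ResolutionOfSingularities.Theses.WeightedInvariant
import Summits.ResolutionOfSingularities.ResolutionOfSingularities.Theorems.WeightedInvariantDatumToEmbeddedRegular
import Literature.AlgebraicGeometry.Resolution.NonReducedNoResolution
import Literature.AlgebraicGeometry.Resolution.AbsoluteIntegralClosureNoResolution
import Literature.AlgebraicGeometry.Resolution.ResolutionProjectiveReduction
import Literature.AlgebraicGeometry.Resolution.AlterationsStrong
import Literature.AlgebraicGeometry.Resolution.RegularLocalRingsNormal
import Literature.AlgebraicGeometry.Motives.VarietiesProjectiveSpaceProofs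
import Literature.AlgebraicGeometry.Motives.VarietiesProperProofs

/-!
# Disproof of `DatumToEmbedded` (crux stmt-ResolutionOfSingularities-0572) — findings

Standing-adversary work file (cdisprove, gen 1 / cycle 1, v1.2 2026-08-16,
refuter-cdisprove-stmt-ResolutionOfSingularities-0572-0). Prose only in docstrings; every
`theorem` below is sorry-free (no NEAR-MISS needs a `sorry` in this version). Imports are explicit
(the check farm's snapshot of the route file lags the tree; nothing here relies on its transitive
imports or on the deciding theorem `closes`).

LANDED (importable, all ACCEPTED 2026-08-16): §1–§3 (web, weakenable/decoration hypotheses) as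
`Summit.ResolutionOfSingularities.ResolutionOfSingularities.Theorems.DatumToEmbedded.Negative.LoadBearing`
(p89859, file `Theorems/DatumToEmbedded/Negative/LoadBearing.lean`); §3 witnesses (fat point,
`𝔽_p[X]⁺`, `smooth_affineSpace`, crux-without-`IsIntegral` ⟺ no datum anywhere) as
`….Negative.LoadBearingHypotheses` (p89865); §4 (cusp) as `….Negative.StrengtheningIsRegular` (p89867,
reviewed). Names there carry the prefix `datumToEmbedded_`; this work file keeps the short names.

THE CRUX. `DatumToEmbedded` (route WeightedInvariant, leaf crux since rev 13):
`∀ p prime, Nonempty (WeightedResolutionDatum p) → EmbeddedPerfectResAt p`, where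
`EmbeddedPerfectResAt p` (§0) says: for every PERFECT field `k` of characteristic `p`, every smooth
separated quasi-compact `f : Y → Spec k`, every closed immersion `i : X → Y` with `X` INTEGRAL,
`X` has a resolution (`Scheme.HasResolution`: proper, birational = iso over a dense open with dense
preimage, regular source).

## Findings (cycle 1)

* §1 THE CONCLUSION BLOCK IS THE PERFECT-FIELD RESOLUTION CONJECTURE, prime by prime:
  `EmbeddedPerfectResAt p ↔ PerfectResAt p` (`embeddedPerfectResAt_iff_perfectResAt`; →: the
  `ℙⁿ_k` are smooth separated quasi-compact and the projective integral case suffices —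
  `ResolutionOverUpToDim.of_projective`, Chow + components + projective closure, all in tree; ←: an
  integral closed subscheme of a smooth separated quasi-compact `Y` is a reduced separated scheme of
  finite type). The embedding `i : X ↪ Y`, `Y` smooth, carries NO information usable by a refuter:
  every quasi-projective variety is so embedded, and Chow reaches the rest.
* §2 POSITION IN THE WEB — WHY IT RESISTS. `crux ↔ ∀ p prime, (Nonempty (WeightedResolutionDatum p)
  → PerfectResAt p)` (`crux_iff_construction_imp_thesis`): the crux is EXACTLY "construction ⇒
  thesis, prime by prime". Hence `WeightedThesis → crux` (`crux_of_weightedThesis`), `summit → crux`,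
  `¬crux → ¬WeightedThesis → ¬summit` (`not_weightedThesis_of_not_crux`, `not_summit_of_not_crux`),
  and a kill must exhibit, AT ONE PRIME, both a weighted resolution datum (i.e. settle crux
  `WeightedConstruction` = stmt-0571 positively there) and a counterexample to resolution of
  singularities over a perfect field (`construction_and_counterexample_of_not_crux`) — the second
  half alone is a dimension-≥ 4 counterexample to the resolution conjecture (modulo the named fact
  `CossartPiltant2019`, `crux_iff_minimalCase`), of which none is in print. Conversely the crux
  holds VACUOUSLY if no datum exists at any prime (`crux_of_forall_isEmpty`), and given
  `WeightedConstruction` it is literally the route target (`crux_iff_weightedThesis_of_construction`).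
  The datum hypothesis is the only thing separating the crux from the open problem:
  `cruxWithoutDatum ↔ WeightedThesis` (`cruxWithoutDatum_iff_weightedThesis`).
* §3 LOAD-BEARING HYPOTHESES of the conclusion block, as theorems (datum untouched):
  - `IsIntegral X` dropped ⇒ the block is FALSE at every prime (`conclusion_false_without_isIntegral_at`,
    witness the fat point `Spec 𝔽_p[ε] ↪ 𝔸¹_{𝔽_p}`; `𝔸¹ → Spec 𝔽_p` smooth via the tree's
    `isStandardSmoothOfRelativeDimension_mvPolynomial_fin`); so the crux without `IsIntegral` is
    EQUIVALENT to `∀ p prime, IsEmpty (WeightedResolutionDatum p)` (`cruxWithoutIsIntegral_iff`), i.e.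
    jointly inconsistent with `WeightedConstruction` at any prime. But `IsIntegral` MAY be weakened to
    `IsReduced` (`embeddedPerfectResAt_iff_reduced`, components): the exact load is "generically
    reduced", and the prover's P1 only needs reducedness to keep centres nowhere dense.
  - `IsClosedImmersion i` dropped (any `i : X → Y`) ⇒ FALSE at every prime
    (`conclusion_false_without_isClosedImmersion_at`, witness `Spec 𝔽_p[X]⁺ → Spec 𝔽_p = Y`, `f = 𝟙`);
    `Smooth f` dropped ⇒ FALSE at every prime (`conclusion_false_without_smooth_at`, witness
    `Y = X = Spec 𝔽_p[X]⁺`, `i = 𝟙`). Both witnesses are non-Noetherian: what these two hypotheses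
    jointly carry is FINITE TYPE of `X`; replacing `Smooth f` by `LocallyOfFiniteType f` gives back
    exactly `PerfectResAt p` (`conclusion_finiteType_iff`) — smoothness of the ambient `Y` is used by
    the PROOF (the datum lives on smooth `Y`), never by the statement.
  - `[PerfectField k]` dropped in the block ⇒ literally the summit, all primes together
    (`conclusionWithoutPerfect_iff_summit`).
  - `p.Prime` dropped ⇒ `(Nonempty (WeightedResolutionDatum 0) → EmbeddedPerfectResAt 0) ∧ crux`
    (`cruxWithoutPrime_iff`); the `p = 0` conjunct follows from `Hironaka1964` — decoration.
  - the DATUM dropped ⇒ `WeightedThesis` (§2).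
* §4 NATURAL STRENGTHENINGS. "`X` is itself regular" is FALSE at every prime already for plane
  curves (`strengthening_isRegular_false`, witness the cusp `Spec 𝔽_p[T², T³] ↪ 𝔸²_{𝔽_p}`; the
  non-regularity proof is the sibling disprover's, stmt-0569 `Negative/LoadBearing.lean`, copied here
  because that module is not built on the check farm at the time of writing). "Resolution that is an
  isomorphism over `Reg X` / projective / snc" — not attackable (true in char 0, open in char p).
  "The cobordant tower end `X_m → X` is itself the resolution" — false on paper (`B₊ → Y` is a
  `𝔾ₘ`-bundle off the centre, not proper: weight-1 blow-up of `0 ∈ 𝔸¹` has `B₊ = 𝔸¹_s × 𝔾ₘ,u → 𝔸¹`,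
  `x = su`, image of `{s = 1}` is `𝔸¹ ∖ 0`, not closed); not formalised (needs the chart computation
  `extReesAlgebra (xⁿ) ≅ k[s, u]`, prover-side material, P2).
* §5 DEGENERATE INSTANCES DO NOT BITE: the non-datum hypotheses are jointly satisfiable with true
  conclusion (`conclusion_hypotheses_satisfiable`: `X = Y = Spec 𝔽_p`); the resolved case is in tree
  (`hasResolution_of_forall_isBot_inv`, P1) so the crux is equivalent to its NON-REGULAR case
  (`crux_iff_nonRegularCase`), where the guard of axioms (iii)/(iv) is on. Satisfiability of the
  datum hypothesis is crux stmt-0571 itself (sibling disprover, 3 cycles: no junk inhabitant, no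
  cheap emptiness — `Cruxes/WeightedConstruction/Disproof.lean` §C3.3); so neither vacuity nor
  decoration of `Nonempty (WeightedResolutionDatum p)` is decidable cheaply.
* §6 INTERFACE NOTES FOR THE PROVER (prose): what the datum does NOT hand over and the proof must
  build — see the §6 docblock; §6b two CHECKED levers for P2's birationality (`isBot_inv_genericPoint`,
  `genericPoint_not_mem_support_centre`: no centre of any datum contains the generic point of an
  integral `X` — the constructive face of `IsIntegral` being load-bearing). None of these gaps is a refutation of the crux AS STATED (its
  conclusion is implied by the summit); per the route's kill criteria an unbridgeable gap would be an
  interface defect of `WeightedResolutionDatum`, to be shown as `IsEmpty`/junk there (stmt-0571's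
  door), not here.
* Targets: none (payload `stuck_stubs = []`; no line picked for this crux yet).

BARRIER CATALOGUE (`Literature/Barriers/ResolutionOfSingularities/`) versus THIS crux: identical
to the sibling's reading for `WeightedThesis` (§1 makes the two conclusion blocks equivalent):
`DimensionFourFrontier` is a frontier entry (no falsity); `QuasiExcellenceNecessary` bites only
beyond finite type (§3 confirms finite type is load-bearing); `InseparableBaseChange*`,
`RegularNotGeometricallyRegular`, `FrobeniusTwistResolution` concern imperfect fields (crux
`DescentPerfectToAll`); `Narasimhan…`, `KangarooShadeIncrease`, `hauserPerlega…`, `Directrix…`,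
`ArtinSchreierPuiseux` are failures of smooth-centre STRATEGIES and bear on the datum's existence
(stmt-0571 / 8899), not on this implication; `LocalMonomializationFails*` is about morphisms.
`ledger negatives --problem ResolutionOfSingularities`: 0 refuted statements (2026-08-16).

WHY IT RESISTS (one paragraph). The statement is an implication whose conclusion is a special case
of the summit and whose hypothesis is the neighbouring open crux; its negation is the conjunction
"a weighted resolution datum exists in characteristic p AND resolution fails over some perfect field
of characteristic p" — the first conjunct is believed FALSE-or-very-hard by everyone who has looked
(ATW 2024 §1.9, AQS arXiv:2412.16426 p. 3), the second is a major open problem with no candidate.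
Cheap attacks (junk models of `HasResolution`, degenerate parameters, hypothesis mutation,
vacuity) are exhausted by §1–§5. The crux can only fall together with the resolution conjecture.
-/

noncomputable section

open CategoryTheory AlgebraicGeometry TopologicalSpace
open Literature.AlgebraicGeometry.Resolution
open Summit.ResolutionOfSingularities.ResolutionOfSingularities.Theses.WeightedInvariant

set_option linter.dupNamespace false

namespace Summit.ResolutionOfSingularities.ResolutionOfSingularities.Cruxes.DatumToEmbedded.Disproof

/-! ## §0 The crux by name -/

/-- The CONCLUSION BLOCK of the crux at a fixed `p`: embedded resolution of INTEGRAL closed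
subschemes of smooth separated quasi-compact schemes over perfect fields of characteristic `p`. -/
def EmbeddedPerfectResAt (p : ℕ) : Prop :=
  ∀ (k : Type) [Field k] [CharP k p] [PerfectField k] (Y X : Scheme.{0})
    (f : Y ⟶ Spec (.of k)) (i : X ⟶ Y), Smooth f → IsSeparated f → QuasiCompact f →
      IsClosedImmersion i → IsIntegral X → Scheme.HasResolution X

/-- Resolution of reduced separated schemes of finite type over perfect fields of characteristic
`p` (the body of the route target `WeightedThesis` at `p`; same `def` as in the sibling work file
`Cruxes/WeightedThesis/Disproof.lean`, restated to keep this file self-contained). -/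
def PerfectResAt (p : ℕ) : Prop :=
  ∀ (k : Type) [Field k] [CharP k p] [PerfectField k] (X : Scheme.{0}) (f : X ⟶ Spec (.of k)),
    IsSeparated f → LocallyOfFiniteType f → QuasiCompact f → IsReduced X → Scheme.HasResolution X

/-- Unfolding: the crux is `∀ p prime, Nonempty (WeightedResolutionDatum p) → EmbeddedPerfectResAt p`.
[folklore] -/
theorem crux_iff :
    DatumToEmbedded ↔
      ∀ p : ℕ, p.Prime → Nonempty (WeightedResolutionDatum p) → EmbeddedPerfectResAt p :=
  Iff.rfl

/-- Unfolding: the route target is `∀ p prime, PerfectResAt p`. [folklore] -/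
theorem weightedThesis_iff : WeightedThesis ↔ ∀ p : ℕ, p.Prime → PerfectResAt p := Iff.rfl

/-- Unfolding: the construction crux is `∀ p prime, Nonempty (WeightedResolutionDatum p)`.
[folklore] -/
theorem weightedConstruction_iff :
    WeightedConstruction ↔ ∀ p : ℕ, p.Prime → Nonempty (WeightedResolutionDatum p) := Iff.rfl

/-! ## §1 The conclusion block is the perfect-field resolution conjecture, prime by prime -/

section Web

/-- **Embedded ⇐ plain, over any field.** If every reduced separated `k`-scheme of finite type has
a resolution then so does every integral closed subscheme of a smooth separated quasi-compact
`k`-scheme: `X → Y → Spec k` is separated, locally of finite type (closed immersion; smooth ⇒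
locally of finite presentation) and quasi-compact, and an integral scheme is reduced. [folklore] -/
theorem embedded_of_plain (k : Type) [Field k]
    (h : ∀ (X : Scheme.{0}) (f : X ⟶ Spec (.of k)), IsSeparated f → LocallyOfFiniteType f →
      QuasiCompact f → IsReduced X → Scheme.HasResolution X)
    (Y X : Scheme.{0}) (f : Y ⟶ Spec (.of k)) (i : X ⟶ Y) [Smooth f] [IsSeparated f]
    [QuasiCompact f] [IsClosedImmersion i] [IsIntegral X] : Scheme.HasResolution X :=
  h X (i ≫ f) inferInstance inferInstance inferInstance inferInstance

/-- **Plain ⇐ embedded, over any field** (the content of the route's derived support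
`DatumToResolution`): if every integral closed subscheme of every smooth separated quasi-compact
`k`-scheme has a resolution, then every reduced separated `k`-scheme of finite type has one. The
`ℙⁿ_k` are smooth (`isSmoothProjective_projectiveSpace_holds`), proper hence separated and
quasi-compact (`isProper_projectiveSpace`), and the projective integral case suffices
(`ResolutionOverUpToDim.of_projective`: irreducible components, Chow's lemma, projective closure —
Cossart–Piltant 2019, proof of Prop. 4.6, Steps 1–3, in tree). [cite: CossartPiltant2019, Prop. 4.6 (proof, Steps 1–3)] -/
theorem plain_of_embedded (k : Type) [Field k]
    (h : ∀ (Y X : Scheme.{0}) (f : Y ⟶ Spec (.of k)) (i : X ⟶ Y), Smooth f → IsSeparated f →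
      QuasiCompact f → IsClosedImmersion i → IsIntegral X → Scheme.HasResolution X)
    (X : Scheme.{0}) (f : X ⟶ Spec (.of k)) [IsSeparated f] [hlft : LocallyOfFiniteType f]
    [hqc : QuasiCompact f] [IsReduced X] : Scheme.HasResolution X := by
  haveI : CompactSpace X := QuasiCompact.compactSpace_of_compactSpace f
  obtain ⟨d, hd⟩ := exists_topologicalKrullDim_le_of_locallyOfFiniteType f
  refine ResolutionOverUpToDim.of_projective (k := k) (d := d) (fun n Z ι hι hint _ => ?_) X f
    inferInstance hlft hqc inferInstance hd
  haveI : IsProper (Literature.AlgebraicGeometry.Motives.projectiveSpace n k).hom :=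
    Literature.AlgebraicGeometry.Motives.isProper_projectiveSpace n k
  haveI : SmoothOfRelativeDimension n (Literature.AlgebraicGeometry.Motives.projectiveSpace n k).hom :=
    (Literature.AlgebraicGeometry.Motives.isSmoothProjective_projectiveSpace_holds k n)
      |>.smoothOfRelativeDimension
  haveI : Smooth (Literature.AlgebraicGeometry.Motives.projectiveSpace n k).hom :=
    SmoothOfRelativeDimension.smooth n _
  exact h _ Z (Literature.AlgebraicGeometry.Motives.projectiveSpace n k).hom ι inferInstance
    inferInstance inferInstance hι hint

/-- **The conclusion block of the crux at `p` is `PerfectResAt p`** (resolution of all reduced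
separated schemes of finite type over all perfect fields of characteristic `p`). [folklore] -/
theorem embeddedPerfectResAt_iff_perfectResAt (p : ℕ) : EmbeddedPerfectResAt p ↔ PerfectResAt p := by
  constructor
  · intro h k _ _ _ X f hsep hlft hqc hred
    exact plain_of_embedded k (fun Y X f i a b c d e => h k Y X f i a b c d e) X f
  · intro h k _ _ _ Y X f i hf hsep hqc hi hint
    exact embedded_of_plain k (fun X f a b c d => h k X f a b c d) Y X f i

end Web

/-! ## §2 Position in the implication web: why it resists -/

section Position

/-- **THE CHARACTERISATION.** The crux is exactly "construction ⇒ thesis, prime by prime":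
`DatumToEmbedded ↔ ∀ p prime, Nonempty (WeightedResolutionDatum p) → PerfectResAt p`.
[folklore] -/
theorem crux_iff_construction_imp_thesis :
    DatumToEmbedded ↔
      ∀ p : ℕ, p.Prime → Nonempty (WeightedResolutionDatum p) → PerfectResAt p := by
  refine forall_congr' fun p => forall_congr' fun _ => forall_congr' fun _ => ?_
  exact embeddedPerfectResAt_iff_perfectResAt p

/-- **The route target implies the crux** (drop the datum). [folklore] -/
theorem crux_of_weightedThesis (h : WeightedThesis) : DatumToEmbedded :=
  crux_iff_construction_imp_thesis.mpr fun p hp _ => h p hp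

/-- **A kill of the crux kills the route target**: `¬ crux → ¬ WeightedThesis`. [folklore] -/
theorem not_weightedThesis_of_not_crux (h : ¬ DatumToEmbedded) : ¬ WeightedThesis :=
  fun hT => h (crux_of_weightedThesis hT)

/-- **A kill of the crux is a counterexample to resolution of singularities in positive
characteristic**: `¬ crux → ¬ summit` (the summit gives resolution over all fields of
characteristic `p`, in particular the perfect ones). [folklore] -/
theorem not_summit_of_not_crux (h : ¬ DatumToEmbedded) : ¬ _root_.ResolutionOfSingularities :=
  fun hs => not_weightedThesis_of_not_crux h fun p hp k _ _ _ X f a b c d => hs p hp k X f a b c d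

/-- **What a kill must exhibit, at ONE prime: a weighted resolution datum AND a counterexample to
resolution over a perfect field.** [folklore] -/
theorem construction_and_counterexample_of_not_crux (h : ¬ DatumToEmbedded) :
    ∃ p : ℕ, p.Prime ∧ Nonempty (WeightedResolutionDatum p) ∧ ¬ PerfectResAt p := by
  rw [crux_iff_construction_imp_thesis] at h
  push Not at h
  exact h

/-- **Vacuity door.** If NO weighted resolution datum exists at any prime (i.e. the sibling crux
`WeightedConstruction` fails everywhere — the outcome the negative literature suggests but nobody
can prove), the crux holds vacuously. [folklore] -/
theorem crux_of_forall_isEmpty (h : ∀ p : ℕ, p.Prime → IsEmpty (WeightedResolutionDatum p)) :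
    DatumToEmbedded :=
  fun p hp hD => ((h p hp).false hD.some).elim

/-- Pointwise form of the vacuity/thesis dichotomy: the crux holds as soon as, at each prime,
either no datum exists or resolution over perfect fields holds. [folklore] -/
theorem crux_of_forall_isEmpty_or_perfectResAt
    (h : ∀ p : ℕ, p.Prime → IsEmpty (WeightedResolutionDatum p) ∨ PerfectResAt p) :
    DatumToEmbedded := by
  refine crux_iff_construction_imp_thesis.mpr fun p hp hD => ?_
  rcases h p hp with he | hr
  · exact (he.false hD.some).elim
  · exact hr

/-- **Given the construction crux, this crux IS the route target.** [folklore] -/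
theorem crux_iff_weightedThesis_of_construction (hC : WeightedConstruction) :
    DatumToEmbedded ↔ WeightedThesis :=
  ⟨fun h p hp => crux_iff_construction_imp_thesis.mp h p hp (hC p hp), crux_of_weightedThesis⟩

/-- Layer 1 of the route, isolated: construction ∧ crux ⇒ target (the deciding theorem `closes`
does this inside its proof; restated here from in-tree glue only, without `closes`). [folklore] -/
theorem weightedThesis_of_construction_of_crux (hC : WeightedConstruction) (hE : DatumToEmbedded) :
    WeightedThesis :=
  (crux_iff_weightedThesis_of_construction hC).mp hE

/-- Contrapositive bookkeeping: if the crux holds and the target fails, the construction crux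
fails (at the same prime, by the pointwise forms above). [folklore] -/
theorem not_construction_of_crux_of_not_weightedThesis (hE : DatumToEmbedded) (hT : ¬ WeightedThesis) :
    ¬ WeightedConstruction :=
  fun hC => hT (weightedThesis_of_construction_of_crux hC hE)

/-- The crux with the DATUM HYPOTHESIS DROPPED. -/
def CruxWithoutDatum : Prop := ∀ p : ℕ, p.Prime → EmbeddedPerfectResAt p

/-- **Without the datum the crux is literally the route target `WeightedThesis`** (the resolution
conjecture over perfect fields, open in dimension `≥ 4` at every prime): the datum hypothesis is
the only thing separating the crux from the open problem, so any proof must USE the datum.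
[folklore] -/
theorem cruxWithoutDatum_iff_weightedThesis : CruxWithoutDatum ↔ WeightedThesis :=
  forall_congr' fun p => forall_congr' fun _ => embeddedPerfectResAt_iff_perfectResAt p

end Position

/-! ## §2b Shape of a minimal counterexample (modulo `CossartPiltant2019`) -/

section Minimal

/-- The INTEGRAL PROJECTIVE case of dimension `> 3` at `p`: integral closed subschemes of some
`ℙⁿ_k`, `k` perfect of characteristic `p`, of dimension not `≤ 3`. -/
def MinimalCaseAt (p : ℕ) : Prop :=
  ∀ (k : Type) [Field k] [CharP k p] [PerfectField k] (n : ℕ) (X : Scheme.{0})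
    (ι : X ⟶ (Literature.AlgebraicGeometry.Motives.projectiveSpace n k).left),
      IsClosedImmersion ι → IsIntegral X → ¬ topologicalKrullDim X ≤ 3 → Scheme.HasResolution X

/-- **Modulo `CossartPiltant2019`, `PerfectResAt p` is its integral projective case of dimension
`≥ 4`.** (→: a closed subscheme of `ℙⁿ_k` is reduced separated of finite type. ←: components, Chow,
projective closure via `ResolutionOverUpToDim.of_projective`; dimension `≤ 3` by the named fact.)
[cite: CossartPiltant2019, Thm. 1.1] -/
theorem perfectResAt_iff_minimalCase (hCP : CossartPiltant2019.{0}) (p : ℕ) :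
    PerfectResAt p ↔ MinimalCaseAt p := by
  constructor
  · intro h k _ _ _ n X ι hι hint _
    haveI := hι
    haveI := hint
    haveI : IsProper (Literature.AlgebraicGeometry.Motives.projectiveSpace n k).hom :=
      Literature.AlgebraicGeometry.Motives.isProper_projectiveSpace n k
    exact h k X (ι ≫ (Literature.AlgebraicGeometry.Motives.projectiveSpace n k).hom) inferInstance
      inferInstance inferInstance inferInstance
  · intro h k _ _ _ X f hsep hlft hqc hred
    haveI := hlft
    haveI := hqc
    haveI : CompactSpace X := QuasiCompact.compactSpace_of_compactSpace f
    obtain ⟨d, hd⟩ := exists_topologicalKrullDim_le_of_locallyOfFiniteType f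
    refine ResolutionOverUpToDim.of_projective (k := k) (d := d) (fun n Z ι hι hint _ => ?_) X f
      hsep hlft hqc hred hd
    by_cases hdim : topologicalKrullDim Z ≤ 3
    · haveI := hι
      haveI := hint
      haveI : IsProper (Literature.AlgebraicGeometry.Motives.projectiveSpace n k).hom :=
        Literature.AlgebraicGeometry.Motives.isProper_projectiveSpace n k
      exact hCP k Z (ι ≫ (Literature.AlgebraicGeometry.Motives.projectiveSpace n k).hom)
        inferInstance inferInstance inferInstance inferInstance hdim
    · exact h k n Z ι hι hint hdim

/-- **Modulo `CossartPiltant2019` the crux reads: a datum at `p` resolves every integral closed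
subscheme of dimension `≥ 4` of every `ℙⁿ_k`, `k` perfect of characteristic `p`.** So the
`¬ PerfectResAt p` half of a kill (§2) is a projective variety of dimension at least four over a
perfect field without resolution. [cite: CossartPiltant2019, Thm. 1.1] -/
theorem crux_iff_minimalCase (hCP : CossartPiltant2019.{0}) :
    DatumToEmbedded ↔
      ∀ p : ℕ, p.Prime → Nonempty (WeightedResolutionDatum p) → MinimalCaseAt p := by
  rw [crux_iff_construction_imp_thesis]
  refine forall_congr' fun p => forall_congr' fun _ => forall_congr' fun _ => ?_
  exact perfectResAt_iff_minimalCase hCP p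

end Minimal

/-! ## §3 Load-bearing hypotheses of the conclusion block -/

section AffineSpace

/-- **`𝔸ⁿ_k → Spec k` is smooth of relative dimension `n`** (`k` any commutative ring would do; a
field here): `k → k[y₁,…,yₙ]` is standard smooth of relative dimension `n` (tree:
`isStandardSmoothOfRelativeDimension_mvPolynomial_fin`), and Mathlib's `SmoothOfRelativeDimension`
has ring-hom property `Locally (IsStandardSmoothOfRelativeDimension n)`. [cite: Hartshorne1977, III §10 Example 10.0.1] -/
theorem smoothOfRelativeDimension_affineSpace (k : Type) [Field k] (n : ℕ) :
    SmoothOfRelativeDimension n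
      (Spec.map (CommRingCat.ofHom (algebraMap k (MvPolynomial (Fin n) k)))) := by
  rw [HasRingHomProperty.Spec_iff (P := @SmoothOfRelativeDimension n)]
  exact RingHom.locally_of RingHom.isStandardSmoothOfRelativeDimension_respectsIso _
    ((RingHom.isStandardSmoothOfRelativeDimension_algebraMap n).mpr
      (Literature.AlgebraicGeometry.Motives.ProjectiveSpace.isStandardSmoothOfRelativeDimension_mvPolynomial_fin
        k n))

/-- `𝔸ⁿ_k → Spec k` is smooth. [cite: Hartshorne1977, III §10 Example 10.0.1] -/
theorem smooth_affineSpace (k : Type) [Field k] (n : ℕ) :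
    Smooth (Spec.map (CommRingCat.ofHom (algebraMap k (MvPolynomial (Fin n) k)))) :=
  haveI := smoothOfRelativeDimension_affineSpace k n
  SmoothOfRelativeDimension.smooth n _

end AffineSpace

section Integral

/-- The `k`-algebra map `k[y] → k[ε]`, `y ↦ ε`. -/
def toDualNumber (k : Type) [Field k] : MvPolynomial (Fin 1) k →ₐ[k] DualNumber k :=
  MvPolynomial.aeval fun _ => DualNumber.eps

/-- `k[y] → k[ε]` is surjective (`a + bε` is the image of `a + b y`). [folklore] -/
theorem toDualNumber_surjective (k : Type) [Field k] : Function.Surjective (toDualNumber k) := by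
  intro x
  refine ⟨MvPolynomial.C x.fst + MvPolynomial.C x.snd * MvPolynomial.X 0, ?_⟩
  rw [toDualNumber, map_add, map_mul, MvPolynomial.aeval_C, MvPolynomial.aeval_C,
    MvPolynomial.aeval_X]
  obtain ⟨a, b⟩ := x
  change TrivSqZeroExt.inl a + TrivSqZeroExt.inl b * TrivSqZeroExt.inr 1 = (a, b)
  rw [TrivSqZeroExt.inl_mul_inr, smul_eq_mul, mul_one]
  exact TrivSqZeroExt.inl_fst_add_inr_snd_eq (a, b)

/-- **`IsIntegral X` is load-bearing: at every prime the conclusion block with `IsIntegral X`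
dropped is FALSE.** Witness: the fat point `Spec 𝔽_p[ε] ↪ 𝔸¹_{𝔽_p}` (closed immersion: `y ↦ ε`
is surjective; `𝔸¹ → Spec 𝔽_p` smooth, affine hence separated and quasi-compact; `𝔽_p` perfect),
and `Spec 𝔽_p[ε]` has no resolution (`not_hasResolution_spec_dualNumber`: a regular stalk would be
a domain containing the non-zero nilpotent `ε`). [folklore] -/
theorem conclusion_false_without_isIntegral_at (p : ℕ) [Fact p.Prime] :
    ¬ ∀ (k : Type) [Field k] [CharP k p] [PerfectField k] (Y X : Scheme.{0})
        (f : Y ⟶ Spec (.of k)) (i : X ⟶ Y), Smooth f → IsSeparated f → QuasiCompact f →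
          IsClosedImmersion i → Scheme.HasResolution X := by
  intro h
  let f : Spec (.of (MvPolynomial (Fin 1) (ZMod p))) ⟶ Spec (.of (ZMod p)) :=
    Spec.map (CommRingCat.ofHom (algebraMap (ZMod p) (MvPolynomial (Fin 1) (ZMod p))))
  let i : Spec (.of (DualNumber (ZMod p))) ⟶ Spec (.of (MvPolynomial (Fin 1) (ZMod p))) :=
    Spec.map (CommRingCat.ofHom (toDualNumber (ZMod p)).toRingHom)
  haveI : Smooth f := smooth_affineSpace (ZMod p) 1
  haveI : IsClosedImmersion i :=
    IsClosedImmersion.spec_of_surjective _ (toDualNumber_surjective (ZMod p))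
  exact not_hasResolution_spec_dualNumber (ZMod p)
    (h (ZMod p) _ _ f i inferInstance inferInstance inferInstance inferInstance)

/-- The crux with `IsIntegral X` DROPPED from its conclusion block (datum kept). -/
def CruxWithoutIsIntegral : Prop :=
  ∀ p : ℕ, p.Prime → Nonempty (WeightedResolutionDatum p) →
    ∀ (k : Type) [Field k] [CharP k p] [PerfectField k] (Y X : Scheme.{0})
      (f : Y ⟶ Spec (.of k)) (i : X ⟶ Y), Smooth f → IsSeparated f → QuasiCompact f →
        IsClosedImmersion i → Scheme.HasResolution X

/-- **Without `IsIntegral X` the crux is EQUIVALENT to "no weighted resolution datum exists at any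
prime"** (`¬` of `WeightedConstruction` at EVERY prime): its conclusion block is false at every prime,
so it holds iff its hypothesis is never met. In particular it is refutable exactly when stmt-0571
is provable at some prime — the same door as for the crux itself, with the open problem removed.
[folklore] -/
theorem cruxWithoutIsIntegral_iff :
    CruxWithoutIsIntegral ↔ ∀ p : ℕ, p.Prime → IsEmpty (WeightedResolutionDatum p) := by
  constructor
  · intro h p hp
    refine ⟨fun D => ?_⟩
    haveI : Fact p.Prime := ⟨hp⟩
    exact conclusion_false_without_isIntegral_at p (h p hp ⟨D⟩)
  · intro h p hp hD
    exact ((h p hp).false hD.some).elim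

/-- Hence a single datum at a single prime refutes the integral-free crux. [folklore] -/
theorem not_cruxWithoutIsIntegral_of_datum {p : ℕ} (hp : p.Prime) (D : WeightedResolutionDatum p) :
    ¬ CruxWithoutIsIntegral :=
  fun h => (cruxWithoutIsIntegral_iff.mp h p hp).false D

/-- … and `WeightedConstruction ∧ CruxWithoutIsIntegral` is inconsistent. [folklore] -/
theorem not_construction_and_cruxWithoutIsIntegral : ¬ (WeightedConstruction ∧ CruxWithoutIsIntegral) :=
  fun ⟨hC, h⟩ => not_cruxWithoutIsIntegral_of_datum Nat.prime_two (hC 2 Nat.prime_two).some h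

open Scheme.IdealSheafData in
/-- **But `IsIntegral X` may be WEAKENED to `IsReduced X`**: the block with `IsReduced X` is
equivalent to the block as stated (→ via §1: the block gives `PerfectResAt p`, which applies to a
reduced closed subscheme of a smooth separated quasi-compact `Y`; ← an integral scheme is reduced).
The exact load carried by `IsIntegral` is therefore "reduced" (generically reduced would do for
`HasResolution`, cf. the line-with-embedded-point `Spec k[x,y]/(x², xy)`, which the normalisation of
its reduction resolves in the sense of `IsBirational`). [folklore] -/
theorem embeddedPerfectResAt_iff_reduced (p : ℕ) :
    EmbeddedPerfectResAt p ↔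
      ∀ (k : Type) [Field k] [CharP k p] [PerfectField k] (Y X : Scheme.{0})
        (f : Y ⟶ Spec (.of k)) (i : X ⟶ Y), Smooth f → IsSeparated f → QuasiCompact f →
          IsClosedImmersion i → IsReduced X → Scheme.HasResolution X := by
  constructor
  · intro h k _ _ _ Y X f i hf hsep hqc hi hred
    haveI := hf; haveI := hsep; haveI := hqc; haveI := hi; haveI := hred
    have hP : PerfectResAt p := (embeddedPerfectResAt_iff_perfectResAt p).mp h
    exact hP k X (i ≫ f) inferInstance inferInstance inferInstance inferInstance
  · intro h k _ _ _ Y X f i hf hsep hqc hi hint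
    haveI := hint
    exact h k Y X f i hf hsep hqc hi inferInstance

end Integral

section FiniteType

open Polynomial in
/-- **`IsClosedImmersion i` is load-bearing: with `i : X → Y` arbitrary the block is FALSE at every
prime.** Witness: `Y = Spec 𝔽_p` (smooth over itself), `X = Spec 𝔽_p[X]⁺` the absolute integral
closure of the affine line (integral: a subring of a field), `i` its structure map;
`Spec 𝔽_p[X]⁺` has no resolution (`not_hasResolution_spec_absoluteIntegralClosure`: every
non-generic stalk is non-Noetherian). [folklore] -/
theorem conclusion_false_without_isClosedImmersion_at (p : ℕ) [Fact p.Prime] :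
    ¬ ∀ (k : Type) [Field k] [CharP k p] [PerfectField k] (Y X : Scheme.{0})
        (f : Y ⟶ Spec (.of k)) (i : X ⟶ Y), Smooth f → IsSeparated f → QuasiCompact f →
          IsIntegral X → Scheme.HasResolution X := by
  intro h
  let i : Spec (.of ↥(integralClosure (ZMod p)[X] (AlgebraicClosure (RatFunc (ZMod p))))) ⟶
      Spec (.of (ZMod p)) :=
    Spec.map (CommRingCat.ofHom ((algebraMap (ZMod p)[X]
      ↥(integralClosure (ZMod p)[X] (AlgebraicClosure (RatFunc (ZMod p))))).comp Polynomial.C))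
  exact not_hasResolution_spec_absoluteIntegralClosure p
    (h (ZMod p) (Spec (.of (ZMod p))) _ (𝟙 _) i inferInstance inferInstance inferInstance
      inferInstance)

open Polynomial in
/-- **`Smooth f` is load-bearing (as the carrier of finite type): with `Smooth f` dropped the block
is FALSE at every prime.** Witness: `Y = X = Spec 𝔽_p[X]⁺`, `i = 𝟙` (an isomorphism is a closed
immersion), `f` the affine (hence separated, quasi-compact) structure map. [folklore] -/
theorem conclusion_false_without_smooth_at (p : ℕ) [Fact p.Prime] :
    ¬ ∀ (k : Type) [Field k] [CharP k p] [PerfectField k] (Y X : Scheme.{0})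
        (f : Y ⟶ Spec (.of k)) (i : X ⟶ Y), IsSeparated f → QuasiCompact f →
          IsClosedImmersion i → IsIntegral X → Scheme.HasResolution X := by
  intro h
  let f : Spec (.of ↥(integralClosure (ZMod p)[X] (AlgebraicClosure (RatFunc (ZMod p))))) ⟶
      Spec (.of (ZMod p)) :=
    Spec.map (CommRingCat.ofHom ((algebraMap (ZMod p)[X]
      ↥(integralClosure (ZMod p)[X] (AlgebraicClosure (RatFunc (ZMod p))))).comp Polynomial.C))
  exact not_hasResolution_spec_absoluteIntegralClosure p
    (h (ZMod p) _ _ f (𝟙 _) inferInstance inferInstance inferInstance inferInstance)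

open Scheme.IdealSheafData in
/-- **What `Smooth f` + `IsClosedImmersion i` carry in the STATEMENT is finite type of `X`, nothing
more**: replacing `Smooth f` by `LocallyOfFiniteType f` turns the block into exactly
`PerfectResAt p` (→: `Y = X`, `i = 𝟙` gives the integral case, then irreducible components,
`hasResolution_of_forall_closeds`; ←: a closed subscheme of a separated finite-type `Y` is
separated of finite type). Smoothness of the ambient scheme is used by the PROOF (the datum lives
on smooth `Y`), not by the statement. [folklore] -/
theorem conclusion_finiteType_iff (p : ℕ) :
    (∀ (k : Type) [Field k] [CharP k p] [PerfectField k] (Y X : Scheme.{0})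
        (f : Y ⟶ Spec (.of k)) (i : X ⟶ Y), LocallyOfFiniteType f → IsSeparated f →
          QuasiCompact f → IsClosedImmersion i → IsIntegral X → Scheme.HasResolution X) ↔
      PerfectResAt p := by
  constructor
  · intro h k _ _ _ X f hsep hlft hqc hred
    haveI := hsep; haveI := hlft; haveI := hqc; haveI := hred
    refine hasResolution_of_forall_closeds X f fun Z hZ => ?_
    haveI := hZ
    exact h k X _ f (vanishingIdeal Z).subschemeι hlft hsep hqc inferInstance hZ
  · intro h k _ _ _ Y X f i hlft hsep hqc hi hint
    haveI := hlft; haveI := hsep; haveI := hqc; haveI := hi; haveI := hint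
    exact h k X (i ≫ f) inferInstance inferInstance inferInstance inferInstance

end FiniteType

section Perfect

/-- **`[PerfectField k]` dropped in the block (all primes together) is literally the summit**:
→ via `plain_of_embedded` (which never used perfectness), ← via `embedded_of_plain`. So inside
the block perfectness is where the whole distance to the summit sits (crux `DescentPerfectToAll`),
exactly as for the route target. [folklore] -/
theorem conclusionWithoutPerfect_iff_summit :
    (∀ p : ℕ, p.Prime → ∀ (k : Type) [Field k] [CharP k p] (Y X : Scheme.{0})
        (f : Y ⟶ Spec (.of k)) (i : X ⟶ Y), Smooth f → IsSeparated f → QuasiCompact f →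
          IsClosedImmersion i → IsIntegral X → Scheme.HasResolution X) ↔
      _root_.ResolutionOfSingularities := by
  constructor
  · intro h p hp k _ _ X f hsep hlft hqc hred
    haveI := hsep; haveI := hlft; haveI := hqc; haveI := hred
    exact plain_of_embedded k (fun Y X f i a b c d e => h p hp k Y X f i a b c d e) X f
  · intro hs p hp k _ _ Y X f i hf hsep hqc hi hint
    haveI := hf; haveI := hsep; haveI := hqc; haveI := hi; haveI := hint
    exact embedded_of_plain k (fun X f a b c d => hs p hp k X f a b c d) Y X f i

end Perfect

section Prime

/-- The crux with `p.Prime` DROPPED. -/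
def CruxWithoutPrime : Prop :=
  ∀ p : ℕ, Nonempty (WeightedResolutionDatum p) → EmbeddedPerfectResAt p

/-- **`p.Prime` dropped ⇒ `(datum at 0 ⇒ embedded resolution in characteristic 0) ∧ crux`**: no
field has characteristic `1` or a composite characteristic (so those instances are vacuous — note
that `WeightedResolutionDatum p` is then trivially inhabited, all its axioms quantifying over
fields of characteristic `p`, but so is the conclusion block empty of instances). [folklore] -/
theorem cruxWithoutPrime_iff :
    CruxWithoutPrime ↔
      (Nonempty (WeightedResolutionDatum 0) → EmbeddedPerfectResAt 0) ∧ DatumToEmbedded := by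
  constructor
  · intro h
    exact ⟨h 0, fun p _ => h p⟩
  · rintro ⟨h0, h⟩ p hD k _ _ _ Y X f i hf hsep hqc hi hint
    rcases CharP.char_is_prime_or_zero k p with hp | rfl
    · exact h p hp hD k Y X f i hf hsep hqc hi hint
    · exact h0 hD k Y X f i hf hsep hqc hi hint

/-- **Modulo Hironaka's theorem `p.Prime` is decoration**: `Hironaka1964` (resolution in
characteristic `0`, named fact) gives the `p = 0` conjunct outright, datum or not.
[cite: Hironaka1964, Main Theorem I] -/
theorem cruxWithoutPrime_iff_crux (hH : Hironaka1964.{0}) : CruxWithoutPrime ↔ DatumToEmbedded := by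
  rw [cruxWithoutPrime_iff]
  refine ⟨fun h => h.2, fun h => ⟨fun _ => ?_, h⟩⟩
  rw [embeddedPerfectResAt_iff_perfectResAt]
  intro k _ _ _ X f a b c d
  exact hH k X f a b c d

end Prime

/-! ## §4 Natural strengthenings -/

section Cusp

open Polynomial

variable (K : Type) [Field K]

/-- Elements of the cusp algebra `K[T², T³] = Algebra.adjoin K {T², T³} ⊆ K[T]` have no linear
term. (Sibling disprover's lemma, stmt-0569 `Theorems/WeightedThesis/Negative/LoadBearing.lean`,
`cusp_coeff_one_eq_zero`; copied because that module is not built on the check farm at the time of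
writing.) [folklore] -/
theorem cusp_coeff_one_eq_zero {s : K[X]}
    (hs : s ∈ Algebra.adjoin K ({X ^ 2, X ^ 3} : Set K[X])) : s.coeff 1 = 0 := by
  refine Algebra.adjoin_induction (p := fun s _ => s.coeff 1 = 0) ?_ ?_ ?_ ?_ hs
  · intro x hx
    simp only [Set.mem_insert_iff, Set.mem_singleton_iff] at hx
    rcases hx with hx | hx <;> rw [hx, Polynomial.coeff_X_pow] <;> simp
  · intro r
    show (algebraMap K K[X] r).coeff 1 = 0
    rw [Polynomial.algebraMap_apply, Polynomial.coeff_C]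
    simp
  · intro x y _ _ hx hy
    simp [hx, hy]
  · intro x y _ _ hx hy
    simp [Polynomial.coeff_mul, Finset.Nat.sum_antidiagonal_succ, hx, hy]

/-- `T ∉ K[T², T³]`. [folklore] -/
theorem cusp_X_not_mem : (X : K[X]) ∉ Algebra.adjoin K ({X ^ 2, X ^ 3} : Set K[X]) := fun h => by
  simpa using cusp_coeff_one_eq_zero K h

/-- `K[T², T³]` is not integrally closed: `T = T³/T²` is integral over it but not in it.
(Sibling's `cusp_not_isIntegrallyClosed`, copied.) [folklore] -/
theorem cusp_not_isIntegrallyClosed :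
    ¬ IsIntegrallyClosed ↥(Algebra.adjoin K ({X ^ 2, X ^ 3} : Set K[X])) := by
  intro h
  set A : Subalgebra K K[X] := Algebra.adjoin K ({X ^ 2, X ^ 3} : Set K[X]) with hA
  have h2 : (X ^ 2 : K[X]) ∈ A := Algebra.subset_adjoin (by simp)
  have h3 : (X ^ 3 : K[X]) ∈ A := Algebra.subset_adjoin (by simp)
  let a2 : A := ⟨X ^ 2, h2⟩
  let a3 : A := ⟨X ^ 3, h3⟩
  have ha2 : a2 ≠ 0 := by
    intro h0
    have := congrArg Subtype.val h0
    simp [a2] at this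
  let L := FractionRing A
  have ha2L : algebraMap A L a2 ≠ 0 := fun h0 =>
    ha2 ((IsFractionRing.injective A L) (h0.trans (map_zero _).symm))
  let x : L := algebraMap A L a3 / algebraMap A L a2
  have hx2 : x ^ 2 = algebraMap A L a2 := by
    rw [div_pow, div_eq_iff (pow_ne_zero 2 ha2L), ← map_pow, ← map_pow, ← map_mul]
    congr 1
    apply Subtype.ext
    simp [a2, a3]
    ring
  obtain ⟨y, hy⟩ := IsIntegrallyClosed.exists_algebraMap_eq_of_isIntegral_pow (R := A) (K := L)
    two_pos (hx2 ▸ isIntegral_algebraMap)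
  have hy' : algebraMap A L (y * a2) = algebraMap A L a3 := by
    rw [map_mul, hy, div_mul_cancel₀ _ ha2L]
  have hy'' : y * a2 = a3 := IsFractionRing.injective A L hy'
  have hval : (y : K[X]) * X ^ 2 = X ^ 3 := by
    have := congrArg Subtype.val hy''
    simpa [a2, a3] using this
  have hyX : (y : K[X]) = X := by
    have hX2 : (X ^ 2 : K[X]) ≠ 0 := pow_ne_zero 2 X_ne_zero
    apply mul_right_cancel₀ hX2
    rw [hval]; ring
  have hXA : (X : K[X]) ∈ A := by rw [← hyX]; exact y.2
  exact cusp_X_not_mem K hXA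

/-- Some maximal ideal of `K[T², T³]` has a non-regular local ring (else every localisation at a
maximal ideal is integrally closed by Matsumura 19.4 = `isIntegrallyClosed_of_isRegularLocalRing`,
hence so is `K[T², T³]`). (Sibling's lemma, copied.) [cite: Matsumura1987, Thm. 19.4] -/
theorem cusp_exists_not_isRegularLocalRing :
    ∃ (m : Ideal ↥(Algebra.adjoin K ({X ^ 2, X ^ 3} : Set K[X]))) (_ : m.IsMaximal),
      ¬ IsRegularLocalRing (Localization.AtPrime m) := by
  by_contra hall
  simp only [not_exists, not_not] at hall
  refine cusp_not_isIntegrallyClosed K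
    (IsIntegrallyClosed.of_localization_maximal fun m _ hm => ?_)
  haveI := hall m hm
  exact isIntegrallyClosed_of_isRegularLocalRing _

/-- **The cuspidal cubic `Spec K[T², T³]` is not regular.** (Sibling's lemma, copied.) [folklore] -/
theorem not_isRegular_spec_cusp :
    ¬ Scheme.IsRegular (Spec (.of ↥(Algebra.adjoin K ({X ^ 2, X ^ 3} : Set K[X])))) := by
  intro h
  obtain ⟨m, hm, hreg⟩ := cusp_exists_not_isRegularLocalRing K
  let x : PrimeSpectrum ↥(Algebra.adjoin K ({X ^ 2, X ^ 3} : Set K[X])) := ⟨m, hm.isPrime⟩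
  haveI := h x
  exact hreg (IsRegularLocalRing.of_ringEquiv
    (Spec.stalkIso (.of ↥(Algebra.adjoin K ({X ^ 2, X ^ 3} : Set K[X]))) x).commRingCatIsoToRingEquiv)

/-- The generators `T², T³` as a `Fin 2`-family: its range is `{T², T³}`. [folklore] -/
theorem range_cuspGen :
    Set.range (fun j : Fin 2 => (X : K[X]) ^ ((j : ℕ) + 2)) = ({X ^ 2, X ^ 3} : Set K[X]) := by
  ext x
  simp only [Set.mem_range, Set.mem_insert_iff, Set.mem_singleton_iff, Fin.exists_fin_two]
  simp only [Fin.val_zero, Fin.val_one]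
  constructor
  · rintro (h | h) <;> [left; right] <;> exact h.symm
  · rintro (h | h) <;> [left; right] <;> exact h.symm

/-- The cusp algebra is the range of `K[x, y] → K[T]`, `x ↦ T²`, `y ↦ T³`. [folklore] -/
theorem cusp_eq_range :
    Algebra.adjoin K ({X ^ 2, X ^ 3} : Set K[X]) =
      (MvPolynomial.aeval fun j : Fin 2 => (X : K[X]) ^ ((j : ℕ) + 2)).range := by
  rw [← range_cuspGen, Algebra.adjoin_range_eq_range_aeval]

/-- **The closed immersion of the cusp into the plane**: `K[x, y] → K[T², T³]`, `x ↦ T²`,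
`y ↦ T³`, as a SURJECTIVE ring map onto the cusp algebra. -/
def toCusp : MvPolynomial (Fin 2) K →+* ↥(Algebra.adjoin K ({X ^ 2, X ^ 3} : Set K[X])) :=
  ((Subalgebra.equivOfEq _ _ (cusp_eq_range K).symm).toAlgHom.comp
    (MvPolynomial.aeval fun j : Fin 2 => (X : K[X]) ^ ((j : ℕ) + 2)).rangeRestrict).toRingHom

/-- `toCusp` is surjective. [folklore] -/
theorem toCusp_surjective : Function.Surjective (toCusp K) := by
  change Function.Surjective
    ((Subalgebra.equivOfEq _ _ (cusp_eq_range K).symm).toAlgHom.comp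
      (MvPolynomial.aeval fun j : Fin 2 => (X : K[X]) ^ ((j : ℕ) + 2)).rangeRestrict)
  exact (Subalgebra.equivOfEq _ _ (cusp_eq_range K).symm).surjective.comp
    (AlgHom.rangeRestrict_surjective _)

/-- **Strengthening "`X` is itself regular" refuted at every prime, already for plane curves**: the
cusp `Spec 𝔽_p[T², T³] ↪ 𝔸²_{𝔽_p}` is an integral closed subscheme of a smooth separated
quasi-compact `𝔽_p`-scheme and is not regular. So `HasResolution X` is not witnessed by `𝟙 X` in
general: the crux has content at every prime in dimension one. [folklore] -/
theorem strengthening_isRegular_false (p : ℕ) [Fact p.Prime] :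
    ¬ ∀ (k : Type) [Field k] [CharP k p] [PerfectField k] (Y X : Scheme.{0})
        (f : Y ⟶ Spec (.of k)) (i : X ⟶ Y), Smooth f → IsSeparated f → QuasiCompact f →
          IsClosedImmersion i → IsIntegral X → Scheme.IsRegular X := by
  intro h
  let f : Spec (.of (MvPolynomial (Fin 2) (ZMod p))) ⟶ Spec (.of (ZMod p)) :=
    Spec.map (CommRingCat.ofHom (algebraMap (ZMod p) (MvPolynomial (Fin 2) (ZMod p))))
  let i : Spec (.of ↥(Algebra.adjoin (ZMod p) ({X ^ 2, X ^ 3} : Set (ZMod p)[X]))) ⟶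
      Spec (.of (MvPolynomial (Fin 2) (ZMod p))) :=
    Spec.map (CommRingCat.ofHom (toCusp (ZMod p)))
  haveI : Smooth f := smooth_affineSpace (ZMod p) 2
  haveI : IsClosedImmersion i := IsClosedImmersion.spec_of_surjective _ (toCusp_surjective (ZMod p))
  exact not_isRegular_spec_cusp (ZMod p)
    (h (ZMod p) _ _ f i inferInstance inferInstance inferInstance inferInstance inferInstance)

end Cusp

/-! ## §5 Degenerate instances do not bite -/

section Degenerate

/-- The spectrum of a field resolves itself. [folklore] -/
theorem hasResolution_Spec_field (K : Type) [Field K] : Scheme.HasResolution (Spec (.of K)) := by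
  refine Scheme.IsRegular.hasResolution fun x => ?_
  haveI : IsRegularLocalRing (Localization.AtPrime x.asIdeal) :=
    IsRegularRing.isRegularLocalRing_localization x.asIdeal
  exact IsRegularLocalRing.of_ringEquiv (Spec.stalkIso (.of K) x).commRingCatIsoToRingEquiv.symm

/-- **Non-vacuity of the conclusion block**: at every prime its hypotheses are jointly satisfiable
with true conclusion (`Y = X = Spec 𝔽_p`, `f = i = 𝟙`). The hypothesis NOT shown satisfiable is
the datum's — that is crux stmt-0571. [folklore] -/
theorem conclusion_hypotheses_satisfiable (p : ℕ) [Fact p.Prime] :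
    ∃ (k : Type) (_ : Field k) (_ : CharP k p) (_ : PerfectField k) (Y X : Scheme.{0})
      (f : Y ⟶ Spec (.of k)) (i : X ⟶ Y), Smooth f ∧ IsSeparated f ∧ QuasiCompact f ∧
        IsClosedImmersion i ∧ IsIntegral X ∧ Scheme.HasResolution X :=
  ⟨ZMod p, inferInstance, inferInstance, inferInstance, Spec (.of (ZMod p)), Spec (.of (ZMod p)),
    𝟙 _, 𝟙 _, inferInstance, inferInstance, inferInstance, inferInstance, inferInstance,
    hasResolution_Spec_field (ZMod p)⟩

/-- **The crux is equivalent to its NON-REGULAR case** (the resolved case is in tree,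
`hasResolution_of_forall_isBot_inv` / `Scheme.IsRegular.hasResolution`, P1 of prover-pitem-0572):
in every remaining instance the guard `∃ y, ¬ IsBot (inv y)` of the datum's axioms (iii)/(iv) is
on (`exists_not_isBot_inv_of_not_isRegular`). [folklore] -/
theorem crux_iff_nonRegularCase :
    DatumToEmbedded ↔
      ∀ p : ℕ, p.Prime → Nonempty (WeightedResolutionDatum p) →
        ∀ (k : Type) [Field k] [CharP k p] [PerfectField k] (Y X : Scheme.{0})
          (f : Y ⟶ Spec (.of k)) (i : X ⟶ Y), Smooth f → IsSeparated f → QuasiCompact f →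
            IsClosedImmersion i → IsIntegral X → ¬ Scheme.IsRegular X →
              Scheme.HasResolution X := by
  constructor
  · intro h p hp hD k _ _ _ Y X f i hf hsep hqc hi hint _
    exact h p hp hD k Y X f i hf hsep hqc hi hint
  · intro h p hp hD k _ _ _ Y X f i hf hsep hqc hi hint
    by_cases hreg : Scheme.IsRegular X
    · exact hreg.hasResolution
    · exact h p hp hD k Y X f i hf hsep hqc hi hint hreg

/-- In the non-regular case the datum's guard is on for `(Y, ker i)` (restating the prover's
`exists_not_isBot_inv_of_not_isRegular` at the crux's binders, so that triage/ideation can cite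
one line). [folklore] -/
theorem guard_of_not_isRegular {p : ℕ} (D : WeightedResolutionDatum p) {k : Type} [Field k]
    [CharP k p] [PerfectField k] {Y X : Scheme.{0}} (f : Y ⟶ Spec (.of k)) [Smooth f]
    [IsSeparated f] [QuasiCompact f] (i : X ⟶ Y) [IsClosedImmersion i]
    (h : ¬ Scheme.IsRegular X) : ∃ y : Y, ¬ IsBot (D.inv f i.ker y) :=
  Summit.ResolutionOfSingularities.ResolutionOfSingularities.Theorems.exists_not_isBot_inv_of_not_isRegular
    D f i h

end Degenerate

/-! ## §6 Interface notes for the prover (what the datum does NOT hand over)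

Read against `Literature.AlgebraicGeometry.Resolution.WeightedResolutionDatum` as landed; none of
these is a refutation door for THIS crux (its conclusion is implied by the summit, §2), each is a
proof obligation of stmt-0572, and an unbridgeable one would be an interface defect to be exhibited
on stmt-0571's side (`IsEmpty`/junk datum), per the route's kill criteria.

1. GLOBAL COBORDANT BLOW-UP. Axiom (iv) is chartwise (`cobordantPlus U` for every affine `U`); the
   glued `B₊ → Y` and the compatibility `B₊(U) ×_U (U ∩ V) ≅ B₊(U ∩ V)`-wise (ext Rees algebra
   commutes with localisation for quasi-coherent pieces) are the prover's (P1, evidence files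
   `WeightedCentreCobordantGlobal.lean`, `CobordantStrictTransformCharts.lean`).
2. SMOOTHNESS OF `B₊`. Not an axiom (module docstring of the datum): Włodarczyk 2.3.9 from
   `IsWeightedChart.linearIndependent` (cotangent linear independence at the points of `V(u)`; at
   closed points over a perfect field this is "part of a regular system of parameters", and
   regularity of `B` at closed points propagates by openness of the regular locus). Prover's P1(a).
3. THE TORUS. No `𝔾ₘ`-action is recorded; it comes from the `ℤ`-grading of `extReesAlgebra`.
   Invariance of `inv`/`centre` on `B₊` under it must be DERIVED from (i) (`inv_comap` for the smooth
   maps `act, pr : 𝔾ₘ × B₊ ⇉ B₊`; `centre_comap` needs them smooth AND surjective — they are) once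
   the strict transform is known to be `𝔾ₘ`-stable (`X'.comap act = X'.comap pr`: the saturation
   ideal is homogeneous).
4. PROPERNESS. `B₊(U) → U` is NOT proper (a `𝔾ₘ`-bundle over `U ∖ C`); `X_m → X` is not a
   resolution. Properness appears only after the quotient: `B₊ ⫽ 𝔾ₘ = Proj_Y(⊕ₙ Rₙ)` (weighted
   blow-up coarse space, projective over `Y`), iterated `Y_m ⫽ 𝔾ₘ^m → Y` proper; `X_m ⫽ T → X`
   proper and birational BECAUSE every centre is nowhere dense in the current strict transform —
   which holds as `centre ⊆ {inv ≠ ⊥} = ` non-regular locus (`support_centre_subset` + (ii)) and the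
   strict transform of an integral `X` stays integral (closure of `(X ∖ C) × 𝔾ₘ`), so `IsIntegral`
   (or `IsReduced`, §3) is used exactly here.
5. QUOTIENT SINGULARITIES. `X_m` regular does not make `X_m ⫽ T` regular: finite diagonalisable
   stabilisers `μ_w ⊂ 𝔾ₘ` (including `μ_p`, infinitesimal in characteristic `p`, still linearly
   reductive) give tame abelian quotient = locally toric singularities; resolving them functorially
   is Bergh–Rydh destackification (arXiv:1905.00872 Thm 2) or toric resolution — absent from
   Mathlib; the planner expects a named fact (restated item). The OUTPUT must be a `Scheme`
   (`HasResolution` quantifies `X' : Scheme`): coarse spaces of the stacks involved are schemes here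
   because everything is a global quotient of a quasi-projective-over-`Y` scheme by a torus (GIT),
   but an abstract "algebraic space" detour would not type-check against `HasResolution`.
6. ONE `Γ` FOR ALL DIMENSIONS (route review S2): each step raises `dim Y` by one; the induction is
   on `max inv ∈ Γ` (in tree: `WeightedResolutionDatum.maxinv_induction`), not on dimension, so this
   is harmless for 0572 — it is 0571's burden (ATW's order is not well-founded across dimensions).
-/

/-! ## §6b Two checked levers for P2's birationality step (about an arbitrary datum) -/

section GenericPoint

variable {p : ℕ} (D : WeightedResolutionDatum p) {k : Type} [Field k] [CharP k p] [PerfectField k]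
  {Y X : Scheme.{0}} (f : Y ⟶ Spec (.of k)) [Smooth f] [IsSeparated f] [QuasiCompact f]
  (i : X ⟶ Y) [IsClosedImmersion i] [IsIntegral X]

/-- **The invariant is minimal at the generic point of an integral `X`**: the stalk there is the
function field, a regular local ring; read through axiom (ii) (`isBot_inv_apply_iff`, P1). This is
where `IsIntegral X` enters the weighted algorithm: it keeps every centre off the generic point.
[folklore] -/
theorem isBot_inv_genericPoint : IsBot (D.inv f i.ker (i (genericPoint X))) := by
  rw [Summit.ResolutionOfSingularities.ResolutionOfSingularities.Theorems.isBot_inv_apply_iff D f i]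
  change IsRegularLocalRing X.functionField
  infer_instance

/-- **No centre of any datum contains the generic point of an integral `X`** (under the guard of
(iii)): the support of the centre is the maximum locus (`support_centre`), on which `inv` is not
minimal (`not_isBot_of_isMaxOn`). Hence `X ∖ C` is a non-empty (dense) open of `X` at every step —
the seed of birationality of `X_m ⫽ T → X`; for a NON-reduced `X` this fails (the centre may be all
of `X.support`, cf. §3). [folklore] -/
theorem genericPoint_not_mem_support_centre (hguard : ∃ y : Y, ¬ IsBot (D.inv f i.ker y)) :
    i (genericPoint X) ∉ (D.centre f i.ker).support := by
  rw [D.support_centre f i.ker hguard]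
  intro hmax
  exact D.not_isBot_of_isMaxOn f i.ker hguard hmax (isBot_inv_genericPoint D f i)

/-- Equivalently: the image of the generic point of `X` is never a maximum point of `inv` once `X`
is singular somewhere. [folklore] -/
theorem not_isMax_inv_genericPoint (hguard : ∃ y : Y, ¬ IsBot (D.inv f i.ker y)) :
    ¬ ∀ y' : Y, D.inv f i.ker y' ≤ D.inv f i.ker (i (genericPoint X)) :=
  fun hmax => D.not_isBot_of_isMaxOn f i.ker hguard hmax (isBot_inv_genericPoint D f i)

end GenericPoint

/-! ## §7 Targets and near-misses

* Targets: none (payload `stuck_stubs = []`, no line picked for this crux).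
* No `sorry`. NEAR-MISS not attempted in Lean: non-properness of `affineCobordantBlowup.plusπ` for
  the weight-1 centre `(x) ⊂ k[x]` (§4; needs `extReesAlgebra (fun n => Ideal.span {x ^ n}) ≃ₐ k[s, u]`,
  which is prover-side chart algebra, P2). -/

end Summit.ResolutionOfSingularities.ResolutionOfSingularities.Cruxes.DatumToEmbedded.Disproof

end
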